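import Literature.NumberTheory.EllipticCurves.AnticyclotomicInertiaAboveP
import Literature.NumberTheory.EllipticCurves.ZpExtensionUnramifiedProofs
import Literature.NumberTheory.EllipticCurves.Rubin1991.TwoVariableMainConjecture
import HarnessLib

/-!
# The split-prime `ℤ_p`-line of an imaginary quadratic field as a quotient of any presented
# `ℤ_p²`-tower: for a generator pair `(κ₁, κ₂; γ₁, γ₂)` there is a `ℤ_p`-quotient `κ` of `Γ_K` through the
# pair which is UNRAMIFIED AT `v̄` (all PROVED; no named fact)

de Shalit 1987, II.1.9 / II.4.17 (p. 77): "Let `K_∞` be the unique `ℤ_p` extension of `K` unramified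
outside `𝔭`"; III.1.8 (p. 94): "`Γ' = Gal(K_∞/K)`".  Greenberg, Invent. Math. 47 (1978) §4 p. 94: "Assume
that `p` splits in `L` and let `𝔭` be one of its prime factors. … `L` has a unique `ℤ_p`-extension in
which only the prime `𝔭` is ramified."  In the tree's choice-free vocabulary (`ZpExtension K p` = a
continuous surjection `Γ_K ↠ ℤ_p`; inertia groups = Mathlib's `Ideal.inertia` of the primes `𝔓` of
`\bar ℤ_K = absIntegers (𝓞 K) K` above a place), and RELATIVE TO A PRESENTED TOWER (the users of the
two-variable frame `Rubin1991.IsKatzMeasure₂` hold a generator pair, not the field `K̃_∞`): for `K`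
imaginary quadratic, `p` odd and SPLIT (`v ≠ v̄` above `p`) and any generator pair
`(κ₁, κ₂; γ₁, γ₂)` (`ZpExtension.IsTopGeneratorPair`), THERE IS a `ℤ_p`-quotient `κ` with
`ker κ₁ ∩ ker κ₂ ≤ ker κ` (a line of the presented tower) and `I_𝔓 ≤ ker κ` for every prime `𝔓` of
`\bar ℤ_K` above `v̄` (`exists_le_kerSubgroup_inertia_of_isTopGeneratorPair`).  This is what the
one-variable Gillard fact `DeShalit1987.thmIII212_hasUnitContent_katzBranch` (a `κ` unramified at `v̄`)
needs in order to be read on a two-variable frame through `KatzMeasureMonomialLinesFrames.lean`.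

Proof (no class field theory beyond what the tree already proved):
* the inertia groups above `v̄` have `ℤ_p`-RANK ONE in the tower: for `σ, τ ∈ I_𝔓` the vectors
  `(κ₁σ, κ₂σ)`, `(κ₁τ, κ₂τ) ∈ ℤ_p²` are proportional — the tree's
  `ZpExtension.toAdd_mul_comm_of_mem_inertia_of_ncard_primesOver_eq` (local Kronecker–Weber at the
  completely split `p`, `AnticyclotomicInertiaAboveP.lean` §2), fed with the complete splitting of `(p)`
  (`ncard_primesOver_under_eq_finrank_of_ne`);
* if some `τ₀ ∈ I_{𝔓₀}` has `(κ₁τ₀, κ₂τ₀) = pᵉ(s', t')` with `(s', t')` PRIMITIVE (§1: every non-zero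
  vector of `ℤ_p²` is `pᵉ` times a vector with a unit coordinate), the linear combination
  `κ = t'κ₁ − s'κ₂` (§2, `linComb`) is ONTO `ℤ_p` (its image is a compact subgroup containing the unit
  `±t'` or `∓s'` — value at `γ₁` or `γ₂` —, and a closed subgroup of `ℤ_p` containing a unit is
  everything by density of `ℕ`, `surjective_of_isUnit_toAdd`), kills `ker κ₁ ∩ ker κ₂`, and kills `I_{𝔓₀}`
  (proportionality and `pᵉ ≠ 0` in the domain `ℤ_p`); if `I_{𝔓₀}` is already trivial in the tower,
  `κ = κ₁` works;
* the other primes above `v̄` are `Γ_K`-conjugate to `𝔓₀` (`exists_smul_eq_of_mem_primesAbove_holds`,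
  `mem_inertia_smul_absIntegers_iff`) and `κᵢ` are class functions.
Uniqueness of `κ` (up to `ℤ_pˣ`) is not needed and not proved.  Nothing here concerns an elliptic
curve or a measure.

References: E. de Shalit, *Iwasawa theory of elliptic curves with complex multiplication* (1987),
II.4.17 (p. 77), III.1.8 (p. 94) [deShalit1987]; R. Greenberg, Invent. Math. 47 (1978), §4 p. 94
[Greenberg1978]; L. Washington, *Introduction to Cyclotomic Fields*, §13.1, Prop. 13.2 [Washington1997];
J.-P. Serre, *Local Fields*, XIV §7 (local Kronecker–Weber, through the tree) [SerreLocalFields1979].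
-/

noncomputable section

open scoped Pointwise
open Filter Topology
open NumberField IsDedekindDomain Field
open Literature.NumberTheory.GaloisRepresentations

namespace Literature.NumberTheory.EllipticCurves.ZpExtension

variable {p : ℕ} [Fact p.Prime]

/-! ### §1. Primitive vectors of `ℤ_p²` -/

/-- **Every non-zero vector of `ℤ_p²` is `pᵉ` times a vector with a unit coordinate**
(`x = u·p^{v(x)}` for `x ≠ 0`, Mathlib `PadicInt.unitCoeff_spec`). [cite: Washington1997, §13.1] -/
theorem exists_pow_mul_of_ne_zero (s t : ℤ_[p]) (h : ¬ (s = 0 ∧ t = 0)) :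
    ∃ (e : ℕ) (s' t' : ℤ_[p]), s = (p : ℤ_[p]) ^ e * s' ∧ t = (p : ℤ_[p]) ^ e * t' ∧
      (IsUnit s' ∨ IsUnit t') := by
  by_cases hs : s = 0
  · have ht : t ≠ 0 := fun ht ↦ h ⟨hs, ht⟩
    refine ⟨t.valuation, 0, (PadicInt.unitCoeff ht : ℤ_[p]), by rw [hs, mul_zero], ?_,
      Or.inr (PadicInt.unitCoeff ht).isUnit⟩
    rw [mul_comm]
    exact PadicInt.unitCoeff_spec ht
  by_cases ht : t = 0
  · refine ⟨s.valuation, (PadicInt.unitCoeff hs : ℤ_[p]), 0, ?_, by rw [ht, mul_zero],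
      Or.inl (PadicInt.unitCoeff hs).isUnit⟩
    rw [mul_comm]
    exact PadicInt.unitCoeff_spec hs
  -- both non-zero: factor out the smaller valuation
  rcases le_total s.valuation t.valuation with hle | hle
  · obtain ⟨d, hd⟩ := Nat.exists_eq_add_of_le hle
    refine ⟨s.valuation, (PadicInt.unitCoeff hs : ℤ_[p]),
      (p : ℤ_[p]) ^ d * (PadicInt.unitCoeff ht : ℤ_[p]), ?_, ?_, Or.inl (PadicInt.unitCoeff hs).isUnit⟩
    · rw [mul_comm]; exact PadicInt.unitCoeff_spec hs
    · rw [← mul_assoc, ← pow_add, ← hd, mul_comm]; exact PadicInt.unitCoeff_spec ht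
  · obtain ⟨d, hd⟩ := Nat.exists_eq_add_of_le hle
    refine ⟨t.valuation, (p : ℤ_[p]) ^ d * (PadicInt.unitCoeff hs : ℤ_[p]),
      (PadicInt.unitCoeff ht : ℤ_[p]), ?_, ?_, Or.inr (PadicInt.unitCoeff ht).isUnit⟩
    · rw [← mul_assoc, ← pow_add, ← hd, mul_comm]; exact PadicInt.unitCoeff_spec hs
    · rw [mul_comm]; exact PadicInt.unitCoeff_spec ht

/-! ### §2. Linear combinations of `ℤ_p`-quotients and their surjectivity -/

section LinComb

variable {K : Type*} [Field K]

/-- **The linear combination `a κ₁ + b κ₂ : Γ_K →ₜ* ℤ_p`** of two `ℤ_p`-quotients (additive coordinates,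
written multiplicatively): `σ ↦ a·κ₁(σ) + b·κ₂(σ)`. [cite: Washington1997, §13.1] -/
def linComb (κ₁ κ₂ : ZpExtension K p) (a b : ℤ_[p]) :
    absoluteGaloisGroup K →ₜ* Multiplicative ℤ_[p] where
  toFun σ := Multiplicative.ofAdd (a * Multiplicative.toAdd (κ₁ σ) + b * Multiplicative.toAdd (κ₂ σ))
  map_one' := by simp
  map_mul' σ τ := by
    rw [← ofAdd_add]
    congr 1
    simp only [map_mul, toAdd_mul]
    ring
  continuous_toFun :=
    continuous_ofAdd.comp ((continuous_const.mul (continuous_toAdd.comp (map_continuous κ₁))).add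
      (continuous_const.mul (continuous_toAdd.comp (map_continuous κ₂))))

/-- Unfolding `linComb`. [cite: Washington1997, §13.1] -/
@[simp] theorem linComb_apply (κ₁ κ₂ : ZpExtension K p) (a b : ℤ_[p]) (σ : absoluteGaloisGroup K) :
    linComb κ₁ κ₂ a b σ =
      Multiplicative.ofAdd (a * Multiplicative.toAdd (κ₁ σ) + b * Multiplicative.toAdd (κ₂ σ)) := rfl

/-- **A continuous homomorphism `Γ_K → ℤ_p` whose image contains a unit is ONTO**: the image is a compact,
hence closed, subgroup of `ℤ_p` containing `u`, hence `ℕ·u`, whose closure is `uℤ_p = ℤ_p` (density of `ℕ`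
in `ℤ_p`). [cite: Washington1997, §13.1] -/
theorem surjective_of_isUnit_toAdd [CharZero K] (f : absoluteGaloisGroup K →ₜ* Multiplicative ℤ_[p])
    {σ : absoluteGaloisGroup K} (hu : IsUnit (Multiplicative.toAdd (f σ))) : Function.Surjective f := by
  set u := Multiplicative.toAdd (f σ) with hu_def
  have hS : IsClosed (Set.range fun τ : absoluteGaloisGroup K ↦ Multiplicative.toAdd (f τ)) :=
    (isCompact_range (continuous_toAdd.comp (map_continuous f))).isClosed
  have hn : ∀ n : ℕ, Multiplicative.toAdd (f (σ ^ n)) = (n : ℤ_[p]) * u := fun n ↦ by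
    rw [map_pow, toAdd_pow, nsmul_eq_mul]
  have key : ∀ x : ℤ_[p], u * x ∈ Set.range (fun τ : absoluteGaloisGroup K ↦ Multiplicative.toAdd (f τ)) :=
    fun x ↦ PadicInt.denseRange_natCast.induction_on x (hS.preimage (continuous_id.const_mul u))
      (fun n ↦ ⟨σ ^ n, show Multiplicative.toAdd (f (σ ^ n)) = u * n by rw [hn, mul_comm]⟩)
  obtain ⟨w, hw⟩ := hu
  intro y
  obtain ⟨τ, hτ⟩ := key (↑w⁻¹ * Multiplicative.toAdd y)
  refine ⟨τ, ?_⟩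
  have hτ' : Multiplicative.toAdd (f τ) = Multiplicative.toAdd y := by
    change Multiplicative.toAdd (f τ) = u * (↑w⁻¹ * Multiplicative.toAdd y) at hτ
    rw [hτ, ← hw, ← mul_assoc, Units.mul_inv, one_mul]
  exact Multiplicative.toAdd.injective hτ'

/-- **The `ℤ_p`-quotient `a κ₁ + b κ₂`** for a generator pair `(κ₁, κ₂; γ₁, γ₂)` when `a` or `b` is a unit
(value `a` at `γ₁`, `b` at `γ₂`, so the image contains a unit). [cite: Washington1997, §13.1] -/
def ofLinComb [CharZero K] {κ₁ κ₂ : ZpExtension K p} {γ₁ γ₂ : absoluteGaloisGroup K}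
    (hpair : IsTopGeneratorPair κ₁ κ₂ γ₁ γ₂) (a b : ℤ_[p]) (hab : IsUnit a ∨ IsUnit b) : ZpExtension K p where
  toContinuousMonoidHom := linComb κ₁ κ₂ a b
  surjective := by
    have h₁ : κ₁ γ₁ = Multiplicative.ofAdd 1 := hpair.left
    have h₂ : κ₂ γ₂ = Multiplicative.ofAdd 1 := hpair.right
    rcases hab with ha | hb
    · refine surjective_of_isUnit_toAdd (linComb κ₁ κ₂ a b) (σ := γ₁) ?_
      simp only [linComb_apply, h₁, hpair.apply_left, toAdd_ofAdd, toAdd_one, mul_one, mul_zero, add_zero]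
      exact ha
    · refine surjective_of_isUnit_toAdd (linComb κ₁ κ₂ a b) (σ := γ₂) ?_
      simp only [linComb_apply, hpair.apply_right, h₂, toAdd_one, toAdd_ofAdd, mul_zero, mul_one, zero_add]
      exact hb

/-- Unfolding `ofLinComb`. [cite: Washington1997, §13.1] -/
theorem ofLinComb_apply [CharZero K] {κ₁ κ₂ : ZpExtension K p} {γ₁ γ₂ : absoluteGaloisGroup K}
    (hpair : IsTopGeneratorPair κ₁ κ₂ γ₁ γ₂) (a b : ℤ_[p]) (hab : IsUnit a ∨ IsUnit b)
    (σ : absoluteGaloisGroup K) :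
    ofLinComb hpair a b hab σ =
      Multiplicative.ofAdd (a * Multiplicative.toAdd (κ₁ σ) + b * Multiplicative.toAdd (κ₂ σ)) := rfl

/-- `a κ₁ + b κ₂` kills `ker κ₁ ∩ ker κ₂`: it is a line of the presented `ℤ_p²`-tower.
[cite: Washington1997, §13.1] -/
theorem pairKer_le_kerSubgroup_ofLinComb [CharZero K] {κ₁ κ₂ : ZpExtension K p}
    {γ₁ γ₂ : absoluteGaloisGroup K} (hpair : IsTopGeneratorPair κ₁ κ₂ γ₁ γ₂) (a b : ℤ_[p])
    (hab : IsUnit a ∨ IsUnit b) : pairKer κ₁ κ₂ ≤ (ofLinComb hpair a b hab).kerSubgroup := by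
  intro σ hσ
  obtain ⟨h₁, h₂⟩ := mem_pairKer_iff.mp hσ
  rw [mem_kerSubgroup, ofLinComb_apply, h₁, h₂, toAdd_one, mul_zero, mul_zero, add_zero, ofAdd_zero]

end LinComb

/-! ### §3. The split-prime line through a generator pair -/

section SplitPrime

variable {K : Type} [Field K] [NumberField K]

omit [Fact (Nat.Prime p)] in
/-- `primesEquiv u = p` for a place `u` of `ℚ` containing the rational prime `p`. [folklore] -/
private theorem primesEquiv_eq_of_natCast_mem' {u : HeightOneSpectrum (𝓞 ℚ)} (hp : p.Prime)
    (hu : (p : 𝓞 ℚ) ∈ u.asIdeal) : (Rat.HeightOneSpectrum.primesEquiv u : ℕ) = p := by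
  have h1 : Rat.HeightOneSpectrum.natGenerator u ∣ p := by
    rw [Rat.HeightOneSpectrum.natGenerator_dvd_iff]
    have h2 := Ideal.mem_map_of_mem (Rat.IsIntegralClosure.intEquiv (𝓞 ℚ)) hu
    rwa [map_natCast] at h2
  exact (Nat.prime_dvd_prime_iff_eq (Rat.HeightOneSpectrum.prime_natGenerator u) hp).mp h1

omit [Fact (Nat.Prime p)] in
/-- A place of `K` containing `p` lies above the place `(p)` of `ℚ`. [folklore] -/
private theorem natCast_mem_under_rat' {w : HeightOneSpectrum (𝓞 K)} (hpw : ((p : ℕ) : 𝓞 K) ∈ w.asIdeal) :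
    (p : 𝓞 ℚ) ∈ (w.under (𝓞 ℚ)).asIdeal := by
  rw [HeightOneSpectrum.under_asIdeal, Ideal.under_def, Ideal.mem_comap, map_natCast]
  exact hpw

/-- **Rank one of inertia above `v̄` in a presented `ℤ_p²`-tower (transported).** For `K` imaginary
quadratic, `p` odd and split (`v ≠ v̄` above `p`), two `ℤ_p`-quotients `κ₁, κ₂` and `σ, τ` in the inertia
group of ONE prime `𝔓` of `\bar ℤ_K` above `v̄`: `κ₁(σ)κ₂(τ) = κ₂(σ)κ₁(τ)` — the tree's
`toAdd_mul_comm_of_mem_inertia_of_ncard_primesOver_eq` with its place bookkeeping discharged.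
[cite: SerreLocalFields1979, Ch. XIV §7 Thm. 2] [cite: Greenberg1978, §4 p. 94] -/
theorem toAdd_mul_comm_of_mem_inertia_above (hK : IsImaginaryQuadratic K) (hp2 : p ≠ 2)
    {v vbar : HeightOneSpectrum (𝓞 K)} (hpv : ((p : ℕ) : 𝓞 K) ∈ v.asIdeal)
    (hpvbar : ((p : ℕ) : 𝓞 K) ∈ vbar.asIdeal) (hne : vbar ≠ v) (κ₁ κ₂ : ZpExtension K p)
    {𝔓 : Ideal (absIntegers (𝓞 K) K)} (h𝔓 : 𝔓 ∈ vbar.primesAbove) {σ τ : absoluteGaloisGroup K}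
    (hσ : σ ∈ 𝔓.inertia (absoluteGaloisGroup K)) (hτ : τ ∈ 𝔓.inertia (absoluteGaloisGroup K)) :
    Multiplicative.toAdd (κ₁ σ) * Multiplicative.toAdd (κ₂ τ) =
      Multiplicative.toAdd (κ₂ σ) * Multiplicative.toAdd (κ₁ τ) := by
  have hp : p.Prime := Fact.out
  haveI : Algebra.IsQuadraticExtension ℚ K := ⟨hK.1⟩
  haveI : IsGalois ℚ K := inferInstance
  have hu : (Rat.HeightOneSpectrum.primesEquiv (vbar.under (𝓞 ℚ)) : ℕ) = p :=
    primesEquiv_eq_of_natCast_mem' hp (natCast_mem_under_rat' hpvbar)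
  have hwu : vbar.asIdeal.under (𝓞 ℚ) = (vbar.under (𝓞 ℚ)).asIdeal :=
    (HeightOneSpectrum.under_asIdeal (𝓞 ℚ) vbar).symm
  have hsplit : (((vbar.under (𝓞 ℚ)).asIdeal).primesOver (𝓞 K)).ncard = Module.finrank ℚ K :=
    ncard_primesOver_under_eq_finrank_of_ne hK.1 hpvbar hpv hne.symm
  have hdet := toAdd_mul_comm_of_mem_inertia_of_ncard_primesOver_eq hp2 hu hsplit hwu h𝔓
    κ₁.toContinuousMonoidHom.toMonoidHom κ₂.toContinuousMonoidHom.toMonoidHom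
    κ₁.toContinuousMonoidHom.continuous κ₂.toContinuousMonoidHom.continuous hσ hτ
  exact hdet

/-- Every element of an inertia group above `v̄` is `Γ_K`-conjugate to an element of the inertia group of
a FIXED prime `𝔓₀` above `v̄`, with the same coordinates in the tower (`κᵢ` are class functions).
[cite: NeukirchANT1999, Ch. I §9 Prop. (9.1)] -/
theorem exists_mem_inertia_apply_eq (κ₁ κ₂ : ZpExtension K p) {w : HeightOneSpectrum (𝓞 K)}
    {𝔓₀ 𝔓 : Ideal (absIntegers (𝓞 K) K)} (h𝔓₀ : 𝔓₀ ∈ w.primesAbove) (h𝔓 : 𝔓 ∈ w.primesAbove)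
    {τ : absoluteGaloisGroup K} (hτ : τ ∈ 𝔓.inertia (absoluteGaloisGroup K)) :
    ∃ τ₀ ∈ 𝔓₀.inertia (absoluteGaloisGroup K), κ₁ τ₀ = κ₁ τ ∧ κ₂ τ₀ = κ₂ τ := by
  obtain ⟨g, hg⟩ := HeightOneSpectrum.exists_smul_eq_of_mem_primesAbove_holds h𝔓₀ h𝔓
  refine ⟨g⁻¹ * τ * g, ?_, ?_, ?_⟩
  · rw [← HeightOneSpectrum.mem_inertia_smul_absIntegers_iff, hg]
    exact hτ
  · rw [map_mul, map_mul, map_inv, mul_comm (κ₁ g)⁻¹, inv_mul_cancel_right]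
  · rw [map_mul, map_mul, map_inv, mul_comm (κ₂ g)⁻¹, inv_mul_cancel_right]

/-- **THE SPLIT-PRIME LINE THROUGH A GENERATOR PAIR.** For `K` imaginary quadratic, `p` odd and split in
`K` (`v ≠ v̄` above `p`) and a generator pair `(κ₁, κ₂; γ₁, γ₂)` of `ℤ_p`-quotients of `Γ_K`, there is a
`ℤ_p`-quotient `κ` THROUGH THE PAIR (`ker κ₁ ∩ ker κ₂ ≤ ker κ`) which is UNRAMIFIED AT `v̄` (every inertia
group of `\bar ℤ_K` above `v̄` lies in `ker κ`) — the line `Gal(K_∞/K)` of "the unique `ℤ_p` extension of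
`K` unramified outside `𝔭`" (de Shalit II.4.17, III.1.8; Greenberg 1978 §4), presented inside the given
tower: `κ = t'κ₁ − s'κ₂` for a primitive vector `(s', t')` proportional to the (rank-one) inertia image,
or `κ = κ₁` if the inertia image is trivial.  Uniqueness is not asserted.
[cite: deShalit1987, II.4.17 (p. 77), III.1.8 (p. 94)] [cite: Greenberg1978, §4 p. 94]
[cite: Washington1997, §13.1] -/
theorem exists_le_kerSubgroup_inertia_of_isTopGeneratorPair (hK : IsImaginaryQuadratic K) (hp2 : p ≠ 2)
    {v vbar : HeightOneSpectrum (𝓞 K)} (hpv : ((p : ℕ) : 𝓞 K) ∈ v.asIdeal)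
    (hpvbar : ((p : ℕ) : 𝓞 K) ∈ vbar.asIdeal) (hne : vbar ≠ v)
    {κ₁ κ₂ : ZpExtension K p} {γ₁ γ₂ : absoluteGaloisGroup K} (hpair : IsTopGeneratorPair κ₁ κ₂ γ₁ γ₂) :
    ∃ κ : ZpExtension K p, pairKer κ₁ κ₂ ≤ κ.kerSubgroup ∧
      ∀ 𝔓 ∈ vbar.primesAbove, 𝔓.inertia (absoluteGaloisGroup K) ≤ κ.kerSubgroup := by
  obtain ⟨𝔓₀, h𝔓₀⟩ := vbar.primesAbove_nonempty
  by_cases htriv : ∀ τ ∈ 𝔓₀.inertia (absoluteGaloisGroup K), κ₁ τ = 1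
  · -- the tower is unramified at `v̄` along `κ₁`: take `κ = κ₁`
    refine ⟨κ₁, pairKer_le_left κ₁ κ₂, fun 𝔓 h𝔓 τ hτ ↦ ?_⟩
    obtain ⟨τ₀, hτ₀, h1, -⟩ := exists_mem_inertia_apply_eq κ₁ κ₂ h𝔓₀ h𝔓 hτ
    rw [mem_kerSubgroup, ← h1]
    exact htriv τ₀ hτ₀
  · push Not at htriv
    obtain ⟨τ₀, hτ₀, hne₁⟩ := htriv
    set s : ℤ_[p] := Multiplicative.toAdd (κ₁ τ₀) with hs_def
    set t : ℤ_[p] := Multiplicative.toAdd (κ₂ τ₀) with ht_def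
    have hst : ¬ (s = 0 ∧ t = 0) := fun h ↦ hne₁ (by
      rw [← ofAdd_toAdd (κ₁ τ₀), ← hs_def, h.1, ofAdd_zero])
    obtain ⟨e, s', t', hs, ht, hunit⟩ := exists_pow_mul_of_ne_zero s t hst
    have hab : IsUnit t' ∨ IsUnit (-s') := hunit.symm.imp_right IsUnit.neg
    refine ⟨ofLinComb hpair t' (-s') hab, pairKer_le_kerSubgroup_ofLinComb hpair t' (-s') hab,
      fun 𝔓 h𝔓 τ hτ ↦ ?_⟩
    obtain ⟨τ₁, hτ₁, h1, h2⟩ := exists_mem_inertia_apply_eq κ₁ κ₂ h𝔓₀ h𝔓 hτ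
    -- proportionality on `I_{𝔓₀}`: `κ₁(τ₁)·t = κ₂(τ₁)·s`
    have hprop := toAdd_mul_comm_of_mem_inertia_above hK hp2 hpv hpvbar hne κ₁ κ₂ h𝔓₀ hτ₁ hτ₀
    rw [← hs_def, ← ht_def, hs, ht, h1, h2] at hprop
    -- cancel `pᵉ` in the domain `ℤ_p`
    have hpe : ((p : ℤ_[p]) ^ e) ≠ 0 := pow_ne_zero _ (NeZero.ne _)
    have hzero : t' * Multiplicative.toAdd (κ₁ τ) + (-s') * Multiplicative.toAdd (κ₂ τ) = 0 := by
      have : (p : ℤ_[p]) ^ e * (t' * Multiplicative.toAdd (κ₁ τ) + (-s') * Multiplicative.toAdd (κ₂ τ))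
          = 0 := by
        linear_combination hprop
      exact (mul_eq_zero.mp this).resolve_left hpe
    rw [mem_kerSubgroup, ofLinComb_apply, hzero, ofAdd_zero]

end SplitPrime

end Literature.NumberTheory.EllipticCurves.ZpExtension
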